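/-
Origin: expansion seat `planner-pub-hodgecm-mc-axioms-1-g14-0`, handover #W123 2026-08-20T15:53:55Z md5 bb53c89b418b (PKG 154e820f060f → bb53c89b418b; 208 l.; MECHANICAL (iib-R) rewrite v3.1 of the PKG file as it stands (39 token edits; rules R1x1+RX[h₂']x38)) (`HOME/mc/pub-hodgecm-mc-axioms-1-g14/revendor/kit-r55/stage55/HodgeCM/Model/ThetaHolGerm.lean`, md5 bb53c89b418b, 208 lines);
landed by the gen-22 packager (p-g22) in gate run 55 REPLACES the earlier landed copy of `HodgeCM/Model/ThetaHolGerm.lean` (seat copy carried the packager Origin header of an earlier run (stripped)).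
-/
/-
Origin: CONSTRUCTION seat `planner-pub-hodgecm-mc-theta-3-g9-0` (unit pub-hodgecm-mc-theta-3-g9, gen 9 of mc-theta-3 — theta supply /
second-lift lane; (Θ-sat) RUN-37 pin-packet owner), 2026-08-19.  NEW additive leaf `HodgeCM/Model/ThetaHolGerm.lean`
(RUN-37 kit `t37-mctheta3g9.txt` row #S9).  Imports ONLY `HodgeCM.Model.ThetaHolPin` (mc-autform-2: the holomorphy junction at
the pin).  0 records, 0 `def … : Prop` minted as facts (the three `def`s below are PREDICATES consumed as an admissibility conjunct,
never hypotheses of E), nothing cited, 0 proof-hole.  Expected `#print axioms` ⊆ {propext, Classical.choice, Quot.sound}.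
-/
import Summits.HodgeConjecture.HodgeCM.Model.ThetaHolPin

/-!
# Holomorphic germs along the archimedean component, at every adelic base point

model1's ruling (T-hol) = (h-a) (STATUS 2026-08-19T17:45:39Z) types binder-1's admissibility predicate of row 15
(`Real34Loc.ofThetaGen adm …`, kit `t36-mcbinder1g8.txt` #17) as

  `adm₃₄ Γ k Sit := Sit.IsSaturated ((𝕏).KΓ Γ) ∧ Sit.IsStrict ∧ «archimedean holomorphy type»`,

with the third conjunct phrased on the ARCHIMEDEAN side only, so that (T3) `hhol` becomes an instantiation and (T4)
`htransl` (finite-adelic right translation) preserves it.  This file supplies that conjunct and its two structural facts: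

* § 1 `IsHolGerm ι F` for a function `F : G_U(𝔸) → ℂ²` and the archimedean inclusion `ι : U(2,1) →* G_U(𝔸)`: at EVERY base
  point `y ∈ G_U(𝔸)` the probe `b ↦ F (y · ι (expP b))` is real-differentiable at `b = 0` with complex-linear differential —
  VERBATIM the hypothesis pair `(hd, hlin)` of `restrictHom_mem_D_Hol_thetaSpaceInputIn_of_differentiableAt` (`ThetaHolPin`).
  It is a `ℂ`-submodule condition (`IsHolGerm.zero/add/smul`), invariant under LEFT translation by any `γ`
  (`IsHolGerm.comp_mul_left`, base point `y ↦ γ y`) and under RIGHT translation by any `k` commuting with `ι (U(2,1))`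
  (`IsHolGerm.comp_mul_right`, base point `y ↦ y k`) — the latter is what makes `adm₃₄` stable under (T4).
* § 2 at the pin `𝕏 = thetaSpaceInputIn …`: `IsHolType … Γ k Sit 𝓕 := ∀ F ∈ Sit.thetaForms 𝓕, IsHolGerm ((𝕏).ιinf Γ) F.1`;
  (T3) as an instantiation: `restrictHom_mem_D_Hol_of_isHolType` (= autform-2's junction applied); and the generator criterion
  `isHolType_of_generators` (it suffices to check the generating theta forms `thetaForm j f`, `j ∈ Sit.𝓙`, `f ∈ 𝓕` — for D-6's
  generators this is autform-2's Lie-derivative computation behind `ProductKTypeData.restrictedThetaForm_mem_Hol_of_lieDeriv`).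
-/

set_option autoImplicit false

noncomputable section

open MulAction
open Literature.Geometry.ComplexHyperbolic.BallModel (U21 Ball x₀)
open Literature.NumberTheory.Automorphic Literature.NumberTheory.Weil1964
open Literature.NumberTheory.Automorphic.WeightForms (restrictHom IsLevelCorrected IsWeightMatched)
open Literature.AlgebraicGeometry.HodgeTheory
open Literature.AlgebraicGeometry.ShimuraVarieties
open Literature.NumberTheory.Automorphic.PicardCM
open HodgeCM.Model.SupplyResidual
open HodgeCM.Model.ThetaSpace

namespace HodgeCM
namespace Model

/-! ### § 1. Holomorphic germs along `ι` -/

section Germ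

variable {GU : Type*} [Group GU] (ι : U21 →* GU)

/-- The archimedean probe of `F` at the base point `y`: `b ↦ F (y · ι (expP b))`. -/
abbrev germAt (F : GU → (Fin 2 → ℂ)) (y : GU) : (Fin 2 → ℂ) → (Fin 2 → ℂ) :=
  fun b => F (y * ι (BallForms.expP b))

/-- (Ported verbatim from the HodgeCMPerL package; no docstring in the source.) -/
theorem germAt_apply (F : GU → (Fin 2 → ℂ)) (y : GU) (b : Fin 2 → ℂ) :
    germAt ι F y b = F (y * ι (BallForms.expP b)) := rfl

/-- **`IsHolGerm ι F`**: at every base point `y`, the probe `b ↦ F (y · ι (expP b))` is real-differentiable at `0`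
with complex-linear differential (the pair `(hd, hlin)` of `restrictHom_mem_D_Hol_thetaSpaceInputIn_of_differentiableAt`). -/
def IsHolGerm (F : GU → (Fin 2 → ℂ)) : Prop :=
  (∀ y : GU, DifferentiableAt ℝ (germAt ι F y) 0) ∧
    ∀ (y : GU) (v : Fin 2 → ℂ),
      fderiv ℝ (germAt ι F y) 0 (Complex.I • v) = Complex.I • fderiv ℝ (germAt ι F y) 0 v

variable {ι}

/-- (Ported verbatim from the HodgeCMPerL package; no docstring in the source.) -/
theorem IsHolGerm.differentiableAt {F : GU → (Fin 2 → ℂ)} (hF : IsHolGerm ι F) (y : GU) :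
    DifferentiableAt ℝ (germAt ι F y) 0 := hF.1 y

/-- (Ported verbatim from the HodgeCMPerL package; no docstring in the source.) -/
theorem IsHolGerm.fderiv_I_smul {F : GU → (Fin 2 → ℂ)} (hF : IsHolGerm ι F) (y : GU) (v : Fin 2 → ℂ) :
    fderiv ℝ (germAt ι F y) 0 (Complex.I • v) = Complex.I • fderiv ℝ (germAt ι F y) 0 v := hF.2 y v

/-- (Ported verbatim from the HodgeCMPerL package; no docstring in the source.) -/
theorem IsHolGerm.zero : IsHolGerm ι (0 : GU → (Fin 2 → ℂ)) := by
  have h : ∀ y : GU, germAt ι (0 : GU → (Fin 2 → ℂ)) y = fun _ => 0 := fun _ => rfl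
  refine ⟨fun y => ?_, fun y v => ?_⟩
  · rw [h]; exact differentiableAt_const _
  · rw [h]; simp

/-- (Ported verbatim from the HodgeCMPerL package; no docstring in the source.) -/
theorem IsHolGerm.add {F G : GU → (Fin 2 → ℂ)} (hF : IsHolGerm ι F) (hG : IsHolGerm ι G) : IsHolGerm ι (F + G) := by
  have h : ∀ y : GU, germAt ι (F + G) y = germAt ι F y + germAt ι G y := fun _ => rfl
  refine ⟨fun y => ?_, fun y v => ?_⟩
  · rw [h]; exact (hF.1 y).add (hG.1 y)
  · rw [h, fderiv_add (hF.1 y) (hG.1 y)]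
    show fderiv ℝ (germAt ι F y) 0 (Complex.I • v) + fderiv ℝ (germAt ι G y) 0 (Complex.I • v) =
      Complex.I • (fderiv ℝ (germAt ι F y) 0 v + fderiv ℝ (germAt ι G y) 0 v)
    rw [hF.2 y v, hG.2 y v, smul_add]

/-- (Ported verbatim from the HodgeCMPerL package; no docstring in the source.) -/
theorem IsHolGerm.smul (r : ℂ) {F : GU → (Fin 2 → ℂ)} (hF : IsHolGerm ι F) : IsHolGerm ι (r • F) := by
  have h : ∀ y : GU, germAt ι (r • F) y = r • germAt ι F y := fun _ => rfl
  refine ⟨fun y => ?_, fun y v => ?_⟩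
  · rw [h]; exact (hF.1 y).const_smul r
  · rw [h, fderiv_const_smul (hF.1 y) r]
    show r • fderiv ℝ (germAt ι F y) 0 (Complex.I • v) = Complex.I • (r • fderiv ℝ (germAt ι F y) 0 v)
    rw [hF.2 y v, smul_comm]

/-- (Ported verbatim from the HodgeCMPerL package; no docstring in the source.) -/
theorem IsHolGerm.neg {F : GU → (Fin 2 → ℂ)} (hF : IsHolGerm ι F) : IsHolGerm ι (-F) := by
  simpa using hF.smul (-1 : ℂ)

/-- (Ported verbatim from the HodgeCMPerL package; no docstring in the source.) -/
theorem IsHolGerm.sub {F G : GU → (Fin 2 → ℂ)} (hF : IsHolGerm ι F) (hG : IsHolGerm ι G) : IsHolGerm ι (F - G) := by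
  simpa [sub_eq_add_neg] using hF.add hG.neg

variable (ι) in
/-- The `ℂ`-submodule of functions `G_U(𝔸) → ℂ²` with holomorphic germs along `ι`. -/
def holGerms : Submodule ℂ (GU → (Fin 2 → ℂ)) where
  carrier := {F | IsHolGerm ι F}
  zero_mem' := IsHolGerm.zero
  add_mem' := IsHolGerm.add
  smul_mem' := IsHolGerm.smul

/-- (Ported verbatim from the HodgeCMPerL package; no docstring in the source.) -/
@[simp] theorem mem_holGerms {F : GU → (Fin 2 → ℂ)} : F ∈ holGerms ι ↔ IsHolGerm ι F := Iff.rfl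

/-- LEFT translation by any `γ ∈ G_U(𝔸)` preserves holomorphic germs (base point `y ↦ γ y`). -/
theorem IsHolGerm.comp_mul_left {F : GU → (Fin 2 → ℂ)} (hF : IsHolGerm ι F) (γ : GU) :
    IsHolGerm ι (fun g => F (γ * g)) := by
  have h : ∀ y : GU, germAt ι (fun g => F (γ * g)) y = germAt ι F (γ * y) := fun y => by
    funext b
    show F (γ * (y * ι (BallForms.expP b))) = F (γ * y * ι (BallForms.expP b))
    rw [mul_assoc]
  exact ⟨fun y => by rw [h]; exact hF.1 (γ * y), fun y v => by rw [h]; exact hF.2 (γ * y) v⟩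

/-- RIGHT translation by any `k ∈ G_U(𝔸)` COMMUTING WITH `ι (U(2,1))` (e.g. a finite-adelic element, pin field
`ThetaAdelicSide.comm_fin`) preserves holomorphic germs (base point `y ↦ y k`).  This is what makes the admissibility
conjunct `IsHolType` stable under binder-1's export (T4) `htransl`. -/
theorem IsHolGerm.comp_mul_right {F : GU → (Fin 2 → ℂ)} (hF : IsHolGerm ι F) {k : GU}
    (hk : ∀ x : U21, Commute k (ι x)) : IsHolGerm ι (fun g => F (g * k)) := by
  have h : ∀ y : GU, germAt ι (fun g => F (g * k)) y = germAt ι F (y * k) := fun y => by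
    funext b
    show F (y * ι (BallForms.expP b) * k) = F (y * k * ι (BallForms.expP b))
    rw [mul_assoc y k, (hk (BallForms.expP b)).eq, ← mul_assoc]
  exact ⟨fun y => by rw [h]; exact hF.1 (y * k), fun y v => by rw [h]; exact hF.2 (y * k) v⟩

end Germ

/-! ### § 2. At the pin: the admissibility conjunct `IsHolType`, (T3) as an instantiation, generators -/

section Pin

variable (hHD : exists_isReal_hodgeModel) (hI : hodgePQ_independent_of_hodgeModel)
  (h₁ : BallQuotientUniformised)  (h₃ : CMAbelianVarietyRealised)

variable {L : CMField} {ι₁ : L →+* ℂ} {V : HermSpace3 L ι₁} {c : SeesawCtx L}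

/-- **`IsHolType`** of a `K`-type situation of the pin at level `Γ`, type `k`: every adelic theta form of the situation
with weight function in `𝓕` has holomorphic germs along `ιinf Γ` at every adelic base point. -/
def IsHolType (S : ThetaAdelicSide V c) (h : IsAnisotropic L V.Hm) (Γ : Level V) (k : Fin 4)
    (Sit : KTypeSituation ((thetaSpaceInputIn hHD hI h₁ h₃ S h).P k)
      ((thetaSpaceInputIn hHD hI h₁ h₃ S h).ιinf Γ) ((thetaSpaceInputIn hHD hI h₁ h₃ S h).Δ Γ)
      (thetaSpaceInputIn hHD hI h₁ h₃ S h).κ₁ (thetaSpaceInputIn hHD hI h₁ h₃ S h).τ₁)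
    (𝓕 : Set C(relNormOneIdeles (thetaSpaceInputIn hHD hI h₁ h₃ S h).K (thetaSpaceInputIn hHD hI h₁ h₃ S h).L ⧸
      relNormOneRat (thetaSpaceInputIn hHD hI h₁ h₃ S h).K (thetaSpaceInputIn hHD hI h₁ h₃ S h).L, ℂ)) : Prop :=
  ∀ F ∈ Sit.thetaForms 𝓕, IsHolGerm ((thetaSpaceInputIn hHD hI h₁ h₃ S h).ιinf Γ) F.1

/-- **(T3) `hhol` as an instantiation**: for a situation of holomorphic type, the archimedean restriction of each of
its theta forms lies in `((𝕏).D Γ).Hol` — autform-2's junction `restrictHom_mem_D_Hol_thetaSpaceInputIn_of_differentiableAt`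
applied to the germ data. -/
theorem restrictHom_mem_D_Hol_of_isHolType (S : ThetaAdelicSide V c) (h : IsAnisotropic L V.Hm) (Γ : Level V)
    (k : Fin 4)
    (Sit : KTypeSituation ((thetaSpaceInputIn hHD hI h₁ h₃ S h).P k)
      ((thetaSpaceInputIn hHD hI h₁ h₃ S h).ιinf Γ) ((thetaSpaceInputIn hHD hI h₁ h₃ S h).Δ Γ)
      (thetaSpaceInputIn hHD hI h₁ h₃ S h).κ₁ (thetaSpaceInputIn hHD hI h₁ h₃ S h).τ₁)
    (𝓕 : Set C(relNormOneIdeles (thetaSpaceInputIn hHD hI h₁ h₃ S h).K (thetaSpaceInputIn hHD hI h₁ h₃ S h).L ⧸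
      relNormOneRat (thetaSpaceInputIn hHD hI h₁ h₃ S h).K (thetaSpaceInputIn hHD hI h₁ h₃ S h).L, ℂ))
    (hSit : IsHolType hHD hI h₁ h₃ S h Γ k Sit 𝓕) :
    ∀ θ ∈ Sit.thetaForms 𝓕,
      restrictHom ((thetaSpaceInputIn hHD hI h₁ h₃ S h).ιinf Γ) Sit.hΔ Sit.hη θ ∈
        ((thetaSpaceInputIn hHD hI h₁ h₃ S h).D Γ).Hol :=
  fun θ hθ =>
    restrictHom_mem_D_Hol_thetaSpaceInputIn_of_differentiableAt hHD hI h₁ h₃ S h Γ Sit.hΔ Sit.hη θ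
      (hSit θ hθ).1 (hSit θ hθ).2

/-- **Generator criterion.** `IsHolType` holds as soon as every GENERATING theta form `thetaForm j f` (`j ∈ Sit.𝓙`,
`f ∈ 𝓕`) has holomorphic germs — `Sit.thetaForms 𝓕` is their span and `IsHolGerm` is a submodule condition. -/
theorem isHolType_of_generators (S : ThetaAdelicSide V c) (h : IsAnisotropic L V.Hm) (Γ : Level V) (k : Fin 4)
    (Sit : KTypeSituation ((thetaSpaceInputIn hHD hI h₁ h₃ S h).P k)
      ((thetaSpaceInputIn hHD hI h₁ h₃ S h).ιinf Γ) ((thetaSpaceInputIn hHD hI h₁ h₃ S h).Δ Γ)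
      (thetaSpaceInputIn hHD hI h₁ h₃ S h).κ₁ (thetaSpaceInputIn hHD hI h₁ h₃ S h).τ₁)
    (𝓕 : Set C(relNormOneIdeles (thetaSpaceInputIn hHD hI h₁ h₃ S h).K (thetaSpaceInputIn hHD hI h₁ h₃ S h).L ⧸
      relNormOneRat (thetaSpaceInputIn hHD hI h₁ h₃ S h).K (thetaSpaceInputIn hHD hI h₁ h₃ S h).L, ℂ))
    (hgen : ∀ j ∈ Sit.𝓙, ∀ f ∈ 𝓕,
      IsHolGerm ((thetaSpaceInputIn hHD hI h₁ h₃ S h).ιinf Γ)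
        (((thetaSpaceInputIn hHD hI h₁ h₃ S h).P k).kernelDatum.thetaForm
            (probHaarRelNormOneQuot (thetaSpaceInputIn hHD hI h₁ h₃ S h).K (thetaSpaceInputIn hHD hI h₁ h₃ S h).L)
            ((thetaSpaceInputIn hHD hI h₁ h₃ S h).P k).kernelDatum_thetaLinear Sit.κ j.1 j.2 Sit.ι Sit.hι f).1) :
    IsHolType hHD hI h₁ h₃ S h Γ k Sit 𝓕 := by
  intro F hF
  induction hF using Submodule.span_induction with
  | mem x hx =>
    obtain ⟨j, hj, f, hf, rfl⟩ := hx
    exact hgen j hj f hf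
  | zero => exact IsHolGerm.zero
  | add x y _ _ hx hy => exact hx.add hy
  | smul r x _ hx => exact hx.smul r

end Pin

end Model
end HodgeCM

end
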